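import Literature.Analysis.FluidPDE.LongTimeAverageSlidingWindow

/-!
# G2 `stub_windowsToMean`: a lower bound on every late window bounds the long-time mean from below

Stub G2 (strain gate, wave 1) of the line `Sketch` (duhamel-release) for the crux
`Summit.AnomalousDissipation.AnomalousDissipation.Theses.TwoAndHalfD.TwohalfdThesis`
(stmt-AnomalousDissipation-0206); the statement `stub_windowsToMean` is registered verbatim in the
line's checked skeleton, where it turns the strain carried by every late window of a low-viscosity
member (stub G1) into a lower bound on the honest `limsup` long-time mean strain.

CONTENT (pure real analysis, sliding-window bookkeeping on `(0, ∞)`). Let `φ : ℝ → [0, ∞]` be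
a.e.-measurable on `(0, ∞)` and locally finite there (`∫⁻_{(0,T)} φ < ∞` for every `T > 0`), let
`c > 0`, `s₀ ≥ 0`, `A ≥ 0`, and suppose EVERY late window carries at least `A`:
`ofReal A ≤ ∫⁻_{(0,c)} φ(s + τ) dτ` for all `s ≥ s₀`. Then, for the running means
`⟨φ.toReal⟩_T = T⁻¹ ∫₀ᵀ φ.toReal` (`timeMean`) of `Literature/Analysis/FluidPDE/TurbWave0`:

* `windowsToMean_timeMean_ge` — `A (T - c - s₀) / (c T) ≤ ⟨φ.toReal⟩_T` for every `T ≥ s₀ + c`;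
* `windowsToMean_envelope` — hence a lower envelope `ℓ ≤ ⟨φ.toReal⟩_·` (eventually) with `ℓ(T) → A / c`;
* `stub_windowsToMean` — if the running means are eventually bounded above (so that Mathlib's real
  `limsup` is honest), `A / c ≤ ⟨φ.toReal⟩ := limsup_T ⟨φ.toReal⟩_T` (`longTimeAvgSup`);
* `windowsToMean_le_longTimeAvgInf` — likewise `A / c ≤ liminf_T ⟨φ.toReal⟩_T` (`longTimeAvgInf`)
  under `liminf`-coboundedness (which an eventual upper bound on the running means supplies).

PROOF. Integrate the window bound over the window positions `s ∈ (s₀, T)` and use the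
sliding-window (Tonelli) bound `lintegral_window_le_of_aemeasurable` of
`Literature/Analysis/FluidPDE/LongTimeAverageSlidingWindow`:
`ofReal A · (T - s₀) ≤ ∫⁻_{(s₀,T)} ∫⁻_{(0,c)} φ(s+τ) ≤ ∫⁻_{(0,T)} ∫⁻_{(0,c)} φ(s+τ) ≤ c · ∫⁻_{(0,T+c)} φ`;
by local finiteness this is the real inequality `A (T - s₀) ≤ c · (T + c) ⟨φ.toReal⟩_{T+c}`
(`MeasureTheory.integral_toReal`), i.e. `ℓ(T') := A (T' - c - s₀) / (c T') ≤ ⟨φ.toReal⟩_{T'}` for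
`T' ≥ s₀ + c`. Since `ℓ(T') = A/c - (A (c + s₀)/c) · T'⁻¹ → A / c`,
`A / c = limsup ℓ ≤ limsup_T ⟨φ.toReal⟩_T` (`Filter.limsup_le_limsup`; the coboundedness of `ℓ`
comes from its convergence, the boundedness of the running means is the hypothesis — without it
the real `limsup` of an unbounded family is the junk value `sInf ∅ = 0` and the conclusion fails).
Nothing here is specific to fluids. Supports stmt-AnomalousDissipation-0206.
[folklore: Doering–Foias 2002, §2 (running means `⟨·⟩_T` and their `lim sup`)]
-/

-- the summit path `AnomalousDissipation/AnomalousDissipation` duplicates a namespace component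
set_option linter.dupNamespace false

namespace Summit.AnomalousDissipation.AnomalousDissipation.Theorems.TwohalfdThesis

open MeasureTheory Set Filter Topology
open scoped ENNReal NNReal
open Literature.Analysis.FunctionSpaces Literature.Analysis.FluidPDE

/-! ## The integrated window bound -/

/-- **Integrated window bound (`ℝ≥0∞` form).** If every window `(s, s + c)` with `s ≥ s₀ ≥ 0`
carries at least `A` (`ofReal A ≤ ∫⁻_{(0,c)} φ(s + τ) dτ`) and `φ` is a.e.-measurable on `(0, ∞)`,
then `ofReal A · ofReal (T - s₀) ≤ ofReal c · ∫⁻_{(0,T+c)} φ` for every `T`: integrate the window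
bound over `s ∈ (s₀, T) ⊆ (0, T)` and apply the sliding-window (Tonelli) bound
`lintegral_window_le_of_aemeasurable`. [folklore] -/
theorem windowsToMean_lintegral_ge {φ : ℝ → ℝ≥0∞} (hφ : AEMeasurable φ (volume.restrict (Ioi 0)))
    {A c s₀ : ℝ} (hs₀ : 0 ≤ s₀)
    (hwin : ∀ s, s₀ ≤ s → ENNReal.ofReal A ≤ ∫⁻ τ in Ioo 0 c, φ (s + τ)) (T : ℝ) :
    ENNReal.ofReal A * ENNReal.ofReal (T - s₀) ≤ ENNReal.ofReal c * ∫⁻ t in Ioo 0 (T + c), φ t :=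
  calc ENNReal.ofReal A * ENNReal.ofReal (T - s₀)
      = ∫⁻ _ in Ioo s₀ T, ENNReal.ofReal A := by rw [setLIntegral_const, Real.volume_Ioo]
    _ ≤ ∫⁻ s in Ioo s₀ T, ∫⁻ τ in Ioo 0 c, φ (s + τ) :=
        setLIntegral_mono' measurableSet_Ioo fun s hs => hwin s hs.1.le
    _ ≤ ∫⁻ s in Ioo 0 T, ∫⁻ τ in Ioo 0 c, φ (s + τ) :=
        lintegral_mono_set (Ioo_subset_Ioo_left hs₀)
    _ ≤ ENNReal.ofReal c * ∫⁻ t in Ioo 0 (T + c), φ t := lintegral_window_le_of_aemeasurable hφ c T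

/-- **Integrated window bound (real form).** Under the hypotheses of `windowsToMean_lintegral_ge`,
with `A, c ≥ 0`, `T ≥ s₀` and `∫⁻_{(0,T+c)} φ < ∞`: `A (T - s₀) ≤ c · (∫⁻_{(0,T+c)} φ).toReal`. [folklore] -/
theorem windowsToMean_toReal_ge {φ : ℝ → ℝ≥0∞} (hφ : AEMeasurable φ (volume.restrict (Ioi 0)))
    {A c s₀ : ℝ} (hA : 0 ≤ A) (hc : 0 ≤ c) (hs₀ : 0 ≤ s₀)
    (hwin : ∀ s, s₀ ≤ s → ENNReal.ofReal A ≤ ∫⁻ τ in Ioo 0 c, φ (s + τ)) {T : ℝ} (hT : s₀ ≤ T)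
    (hfin : ∫⁻ t in Ioo 0 (T + c), φ t ≠ ∞) :
    A * (T - s₀) ≤ c * (∫⁻ t in Ioo 0 (T + c), φ t).toReal := by
  have h := ENNReal.toReal_mono (ENNReal.mul_ne_top ENNReal.ofReal_ne_top hfin)
    (windowsToMean_lintegral_ge hφ hs₀ hwin T)
  rwa [ENNReal.toReal_mul, ENNReal.toReal_mul, ENNReal.toReal_ofReal hA,
    ENNReal.toReal_ofReal (sub_nonneg.2 hT), ENNReal.toReal_ofReal hc] at h

/-- **Running mean of `φ.toReal` through the lower integral.** For `φ` a.e.-measurable on `(0, ∞)`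
with `∫⁻_{(0,T)} φ < ∞` and `T ≥ 0`: `⟨φ.toReal⟩_T = T⁻¹ · (∫⁻_{(0,T)} φ).toReal`
(`timeMean`, `intervalIntegral.integral_of_le`, `integral_Ioc_eq_integral_Ioo`,
`MeasureTheory.integral_toReal`). [folklore] -/
theorem windowsToMean_timeMean_eq {φ : ℝ → ℝ≥0∞} (hφ : AEMeasurable φ (volume.restrict (Ioi 0)))
    {T : ℝ} (hT : 0 ≤ T) (hfin : ∫⁻ t in Ioo 0 T, φ t ≠ ∞) :
    timeMean (fun t => (φ t).toReal) T = T⁻¹ * (∫⁻ t in Ioo 0 T, φ t).toReal := by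
  have hφm : AEMeasurable φ (volume.restrict (Ioo 0 T)) :=
    hφ.mono_measure (Measure.restrict_mono Ioo_subset_Ioi_self le_rfl)
  simp only [timeMean, intervalIntegral.integral_of_le hT]
  rw [integral_Ioc_eq_integral_Ioo, integral_toReal hφm (ae_lt_top' hφm hfin)]

/-- **Lower bound on the running means from a lower bound on every late window.** If
`φ : ℝ → [0, ∞]` is a.e.-measurable and locally finite on `(0, ∞)`, `A ≥ 0`, `c > 0`, `s₀ ≥ 0`, and
`ofReal A ≤ ∫⁻_{(0,c)} φ(s + τ) dτ` for all `s ≥ s₀`, then for every `T ≥ s₀ + c`: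
`A (T - c - s₀) / (c T) ≤ ⟨φ.toReal⟩_T` (`timeMean`). [folklore] -/
theorem windowsToMean_timeMean_ge {φ : ℝ → ℝ≥0∞} (hφ : AEMeasurable φ (volume.restrict (Ioi 0)))
    (hfin : ∀ T, 0 < T → ∫⁻ t in Ioo 0 T, φ t < ⊤) {A c s₀ : ℝ} (hA : 0 ≤ A) (hc : 0 < c)
    (hs₀ : 0 ≤ s₀) (hwin : ∀ s, s₀ ≤ s → ENNReal.ofReal A ≤ ∫⁻ τ in Ioo 0 c, φ (s + τ))
    {T : ℝ} (hT : s₀ + c ≤ T) :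
    A * (T - c - s₀) / (c * T) ≤ timeMean (fun t => (φ t).toReal) T := by
  have hTpos : 0 < T := by linarith
  have hfinT : ∫⁻ t in Ioo 0 T, φ t ≠ ∞ := (hfin T hTpos).ne
  have hfinT' : ∫⁻ t in Ioo 0 (T - c + c), φ t ≠ ∞ := by rwa [sub_add_cancel]
  have h := windowsToMean_toReal_ge hφ hA hc.le hs₀ hwin (T := T - c) (by linarith) hfinT'
  rw [sub_add_cancel] at h
  rw [windowsToMean_timeMean_eq hφ hTpos.le hfinT, div_le_iff₀ (mul_pos hc hTpos)]
  calc A * (T - c - s₀) ≤ c * (∫⁻ t in Ioo 0 T, φ t).toReal := h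
    _ = T⁻¹ * (∫⁻ t in Ioo 0 T, φ t).toReal * (c * T) := by field_simp

/-- **Lower envelope of the running means.** Under the hypotheses of `windowsToMean_timeMean_ge`
there is a real function `ℓ` with `ℓ(T) → A / c` as `T → ∞` and `ℓ(T) ≤ ⟨φ.toReal⟩_T` eventually
(namely `ℓ(T) = A/c - (A (c + s₀)/c) T⁻¹ = A (T - c - s₀)/(c T)` for `T ≥ s₀ + c`). [folklore] -/
theorem windowsToMean_envelope {φ : ℝ → ℝ≥0∞} (hφ : AEMeasurable φ (volume.restrict (Ioi 0)))
    (hfin : ∀ T, 0 < T → ∫⁻ t in Ioo 0 T, φ t < ⊤) {A c s₀ : ℝ} (hA : 0 ≤ A) (hc : 0 < c)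
    (hs₀ : 0 ≤ s₀) (hwin : ∀ s, s₀ ≤ s → ENNReal.ofReal A ≤ ∫⁻ τ in Ioo 0 c, φ (s + τ)) :
    ∃ ℓ : ℝ → ℝ, Tendsto ℓ atTop (𝓝 (A / c)) ∧
      ∀ᶠ T in atTop, ℓ T ≤ timeMean (fun t => (φ t).toReal) T := by
  refine ⟨fun T => A / c - A * (c + s₀) / c * T⁻¹, ?_, ?_⟩
  · have h := tendsto_const_nhds (x := A / c) |>.sub
      ((tendsto_inv_atTop_zero (𝕜 := ℝ)).const_mul (A * (c + s₀) / c))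
    simpa using h
  · filter_upwards [eventually_ge_atTop (s₀ + c)] with T hT
    have hTpos : 0 < T := by linarith
    have heq : A / c - A * (c + s₀) / c * T⁻¹ = A * (T - c - s₀) / (c * T) := by
      field_simp
      ring
    rw [heq]
    exact windowsToMean_timeMean_ge hφ hfin hA hc hs₀ hwin hT

/-! ## The registered stub -/

/-- **G2 `stub_windowsToMean`.** Sliding-window bookkeeping on `(0, ∞)`: if an a.e.-measurable
`φ : ℝ → [0, ∞]`, locally finite (`∫⁻_{(0,T)} φ < ∞` for `T > 0`), carries at least `A ≥ 0` on EVERY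
window `(s, s + c)` (`c > 0`) with `s ≥ s₀ ≥ 0` (`ofReal A ≤ ∫⁻_{(0,c)} φ(s + τ) dτ`), and the running
means of `φ.toReal` are eventually bounded above (so that the real `limsup` is honest), then the
`limsup` long-time mean of `φ.toReal` is `≥ A / c`:
`A / c = lim ℓ = limsup ℓ ≤ limsup_T ⟨φ.toReal⟩_T` for the lower envelope `ℓ` of
`windowsToMean_envelope` (`Filter.limsup_le_limsup`). Registered verbatim in the checked skeleton of
line `Sketch` for stmt-AnomalousDissipation-0206. [folklore] -/
theorem stub_windowsToMean :
    ∀ (φ : ℝ → ℝ≥0∞) (A c s₀ : ℝ), AEMeasurable φ (volume.restrict (Ioi 0)) →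
      (∀ T, 0 < T → ∫⁻ t in Ioo 0 T, φ t < ⊤) → 0 ≤ A → 0 < c → 0 ≤ s₀ →
      (∀ s, s₀ ≤ s → ENNReal.ofReal A ≤ ∫⁻ τ in Ioo 0 c, φ (s + τ)) →
      IsBoundedUnder (· ≤ ·) atTop (timeMean fun t => (φ t).toReal) →
      A / c ≤ longTimeAvgSup (fun t => (φ t).toReal) := by
  intro φ A c s₀ hφ hfin hA hc hs₀ hwin hbdd
  obtain ⟨ℓ, hℓ, hev⟩ := windowsToMean_envelope hφ hfin hA hc hs₀ hwin
  calc A / c = limsup ℓ atTop := hℓ.limsup_eq.symm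
    _ ≤ limsup (timeMean fun t => (φ t).toReal) atTop :=
        limsup_le_limsup hev hℓ.isCoboundedUnder_le hbdd

/-- **`liminf` version of `stub_windowsToMean`.** Under the same window hypotheses, if the running
means of `φ.toReal` are `liminf`-cobounded (`IsCoboundedUnder (· ≥ ·)`; e.g. eventually bounded
above, `Filter.IsBoundedUnder.isCoboundedUnder_ge`), then also
`A / c ≤ liminf_T ⟨φ.toReal⟩_T` (`longTimeAvgInf`; `Filter.liminf_le_liminf` against the lower
envelope of `windowsToMean_envelope`). Without coboundedness the real `liminf` of a family tending
to `+∞` is the junk value `sSup univ = 0` and the conclusion fails. [folklore] -/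
theorem windowsToMean_le_longTimeAvgInf {φ : ℝ → ℝ≥0∞}
    (hφ : AEMeasurable φ (volume.restrict (Ioi 0)))
    (hfin : ∀ T, 0 < T → ∫⁻ t in Ioo 0 T, φ t < ⊤) {A c s₀ : ℝ} (hA : 0 ≤ A) (hc : 0 < c)
    (hs₀ : 0 ≤ s₀) (hwin : ∀ s, s₀ ≤ s → ENNReal.ofReal A ≤ ∫⁻ τ in Ioo 0 c, φ (s + τ))
    (hcobdd : IsCoboundedUnder (· ≥ ·) atTop (timeMean fun t => (φ t).toReal)) :
    A / c ≤ longTimeAvgInf (fun t => (φ t).toReal) := by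
  obtain ⟨ℓ, hℓ, hev⟩ := windowsToMean_envelope hφ hfin hA hc hs₀ hwin
  calc A / c = liminf ℓ atTop := hℓ.liminf_eq.symm
    _ ≤ liminf (timeMean fun t => (φ t).toReal) atTop :=
        liminf_le_liminf hev hℓ.isBoundedUnder_ge hcobdd

/-- **`liminf` version under an eventual upper bound.** Under the window hypotheses of
`stub_windowsToMean` and with eventually bounded running means, `A / c ≤ liminf_T ⟨φ.toReal⟩_T`
(`longTimeAvgInf`) — the sharper form of the stub, since `liminf ≤ limsup` for bounded families. [folklore] -/
theorem windowsToMean_le_longTimeAvgInf_of_isBoundedUnder {φ : ℝ → ℝ≥0∞}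
    (hφ : AEMeasurable φ (volume.restrict (Ioi 0)))
    (hfin : ∀ T, 0 < T → ∫⁻ t in Ioo 0 T, φ t < ⊤) {A c s₀ : ℝ} (hA : 0 ≤ A) (hc : 0 < c)
    (hs₀ : 0 ≤ s₀) (hwin : ∀ s, s₀ ≤ s → ENNReal.ofReal A ≤ ∫⁻ τ in Ioo 0 c, φ (s + τ))
    (hbdd : IsBoundedUnder (· ≤ ·) atTop (timeMean fun t => (φ t).toReal)) :
    A / c ≤ longTimeAvgInf (fun t => (φ t).toReal) :=
  windowsToMean_le_longTimeAvgInf hφ hfin hA hc hs₀ hwin hbdd.isCoboundedUnder_ge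

end Summit.AnomalousDissipation.AnomalousDissipation.Theorems.TwohalfdThesis
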